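import Literature.Geometry.Lorentzian.OpensCausality
import Literature.Geometry.Lorentzian.CauchyDevelopmentRestrict
import Literature.Geometry.Lorentzian.CauchyDevelopmentIsometryClasses
import Literature.Geometry.Lorentzian.CommonDevelopmentEmbedding
import HarnessLib

/-!
# Realising a Cauchy development inside a spacetime along an isometric open embedding
# (Sbierski 2016, §2, Remark (2) after Def. 2.4)

Let `𝒰 = (M_𝒰, g_𝒰, τ_𝒰, ι_𝒰, ν_𝒰)` be a Cauchy development of the data `D` on `X`, and let
`J : M_𝒰 → M₁`, `K : M_𝒰 → M₂` be smooth, time-orientation preserving isometric immersions into two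
spacetimes `𝒯₁`, `𝒯₂` of the same dimension, `J` moreover an open embedding, carrying `ι_𝒰` to
prescribed maps `ι₁ = J ∘ ι_𝒰 : X → M₁`, `ι₂ = K ∘ ι_𝒰 : X → M₂`. Then **`U = J(M_𝒰) ⊆ M₁` is an
open connected set containing `ι₁(X)`, in which `ι₁(X)` is a Cauchy hypersurface of the open
sub-spacetime `(U, g₁|_U, τ₁|_U)`, and `ψ = K ∘ J⁻¹ : M₁ → M₂` is smooth, isometric and
time-orientation preserving on `U` with `ψ ∘ ι₁ = ι₂`** (`CauchyDevelopment.exists_realised_range`).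
This is Sbierski's remark that a common globally hyperbolic development in the symmetric sense
(a GHD of the same data of which both are extensions) is realised INSIDE the first spacetime "by
using the isometric embedding that is provided by `M` being an extension of `U`" (Ann. Henri
Poincaré 17 (2016), §2, Remark (2) after Def. 2.4), stated for arbitrary target spacetimes and
explicit maps — the form needed when the two targets are not themselves developments of `D` (the
restart of the local uniqueness argument from a spacelike piece of the boundary of a common
development, §3.2, proof of Thm. 12, where `D` is the data induced on the new slice `S` and
`M₁`, `M₂` are the two original developments).

Ingredients: the inverse of an injective isometric immersion is smooth on its (open) range
(`Spacetime.contMDiffOn_invFun_range`: an isometric immersion of equidimensional Lorentzian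
manifolds is a local diffeomorphism, `LorentzianMetric.isInvertible_mfderiv_of_isIsometricImmersion`
and `Literature.Geometry.Manifold.isLocalDiffeomorphAt_of_mfderiv`), `dJ ∘ d(J⁻¹) = id`
(`Spacetime.mfderiv_comp_mfderiv_invFun`), the converse timecone lemma
(`PreservesTimeOrientation.isFutureDirected_of_mfderiv`), and the transport of endless timelike
curves of `U` along `J⁻¹` to endless timelike curves of `𝒰`, which meet `ι_𝒰(X)` exactly once.
(The same argument, for targets that are Cauchy developments of `D` and maps packaged as
`EmbedsInto`, is `SubdataDevelopmentsEmbed.exists_realised_of_embedsInto` of summit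
`FinalStateConjecture`; the present file is its library form.)

Everything is proved; no definitions, no named facts (D-0026).

## References

* J. Sbierski, *On the existence of a maximal Cauchy development for the Einstein equations: a
  dezornification*, Ann. Henri Poincaré 17 (2016) 301–329 = arXiv:1309.7591v3, §2, Def. 2.4 and
  Remark (2); §3.2, proof of Thm. 12 (arXiv numbering). [Sbierski2016AHP]
* B. O'Neill, *Semi-Riemannian geometry with applications to relativity*, Academic Press 1983,
  Ch. 3, p. 58 and p. 90. [ONeillSemiRiemannian1983]
-/

noncomputable section

open Function Set Filter Topology TopologicalSpace
open scoped Manifold ContDiff Topology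

namespace Literature.Geometry.Lorentzian

universe u

variable {n : ℕ}

/-! ### The inverse of an injective isometric immersion on its range -/

namespace Spacetime

variable {𝒮 𝒮' : Spacetime.{u} (n + 1)} {j : 𝒮.carrier → 𝒮'.carrier}

/-- **The inverse of an injective isometric immersion is smooth on its range.** For a smooth
isometric immersion `j : M → M'` between spacetimes of the same dimension (hence a local
diffeomorphism: its differential is invertible,
`LorentzianMetric.isInvertible_mfderiv_of_isIsometricImmersion`, inverse function theorem
`Literature.Geometry.Manifold.isLocalDiffeomorphAt_of_mfderiv`) which is injective, `Function.invFun j`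
is smooth on the range of `j`: near `j x` it agrees with the inverse of a local diffeomorphism
chart of `j`. O'Neill 1983, Ch. 3, p. 90. [cite: ONeillSemiRiemannian1983, Ch. 3, p. 90] -/
theorem contMDiffOn_invFun_range
    (hj : 𝒮.metric.IsIsometricImmersion 𝒮'.metric.toPseudoRiemannianMetric j) (hinj : Injective j) :
    ContMDiffOn (𝓡 (n + 1)) (𝓡 (n + 1)) ∞ (invFun j) (range j) := by
  haveI : Nonempty 𝒮.carrier := inferInstance
  rintro _ ⟨x, rfl⟩
  obtain ⟨e, he⟩ := LorentzianMetric.isInvertible_mfderiv_of_isIsometricImmersion hj x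
  obtain ⟨Φ, hxΦ, heq⟩ : IsLocalDiffeomorphAt (𝓡 (n + 1)) (𝓡 (n + 1)) ∞ j x :=
    Literature.Geometry.Manifold.isLocalDiffeomorphAt_of_mfderiv (by simp) isOpen_univ (mem_univ x)
      hj.1.contMDiffOn e he.symm
  have hjx : j x ∈ Φ.target := by rw [heq hxΦ]; exact Φ.map_source hxΦ
  have hev : invFun j =ᶠ[𝓝 (j x)] Φ.symm := by
    filter_upwards [Φ.open_target.mem_nhds hjx] with y hy
    have h1 : j (Φ.symm y) = y := (heq (Φ.map_target hy)).trans (Φ.right_inv hy)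
    calc invFun j y = invFun j (j (Φ.symm y)) := by rw [h1]
      _ = Φ.symm y := leftInverse_invFun hinj _
  have hsymm : ContMDiffAt (𝓡 (n + 1)) (𝓡 (n + 1)) ∞ Φ.symm (j x) :=
    (Φ.contMDiffOn_invFun (j x) hjx).contMDiffAt (Φ.open_target.mem_nhds hjx)
  exact (hsymm.congr_of_eventuallyEq hev).contMDiffWithinAt

/-- `dj_x (d(j⁻¹)_{j x} w) = w` for an injective isometric immersion with open range (chain rule
for `j ∘ j⁻¹ = id` near `j x`). [folklore] -/
theorem mfderiv_comp_mfderiv_invFun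
    (hj : 𝒮.metric.IsIsometricImmersion 𝒮'.metric.toPseudoRiemannianMetric j) (hinj : Injective j)
    (ho : IsOpenEmbedding j) (x : 𝒮.carrier) (w : TangentSpace (𝓡 (n + 1)) (j x)) :
    mfderiv (𝓡 (n + 1)) (𝓡 (n + 1)) j (invFun j (j x))
      (mfderiv (𝓡 (n + 1)) (𝓡 (n + 1)) (invFun j) (j x) w) = w := by
  haveI : Nonempty 𝒮.carrier := inferInstance
  have hjd : MDifferentiable (𝓡 (n + 1)) (𝓡 (n + 1)) j := hj.1.mdifferentiable (by simp)
  have hid : MDifferentiableAt (𝓡 (n + 1)) (𝓡 (n + 1)) (invFun j) (j x) :=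
    ((contMDiffOn_invFun_range hj hinj (j x) ⟨x, rfl⟩).contMDiffAt
      (ho.isOpen_range.mem_nhds ⟨x, rfl⟩)).mdifferentiableAt (by simp)
  have hev : (j ∘ invFun j) =ᶠ[𝓝 (j x)] id := by
    filter_upwards [ho.isOpen_range.mem_nhds ⟨x, rfl⟩] with y hy
    exact invFun_eq hy
  have h := mfderiv_comp (j x) (hjd (invFun j (j x))) hid
  have h2 : mfderiv (𝓡 (n + 1)) (𝓡 (n + 1)) (j ∘ invFun j) (j x) =
      ContinuousLinearMap.id ℝ (TangentSpace (𝓡 (n + 1)) (j x)) := by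
    rw [hev.mfderiv_eq, mfderiv_id]
  rw [h2] at h
  exact (congrArg (fun L ↦ L w) h).symm

end Spacetime

/-! ### Realising a Cauchy development inside a spacetime -/

namespace CauchyDevelopment

variable {X : Type u} [TopologicalSpace X] [ChartedSpace (EuclideanSpace ℝ (Fin n)) X]
  [IsManifold (𝓡 n) ∞ X] [ConnectedSpace X] {D : InitialDataSet (𝓡 n) X}

/-- **Realising a Cauchy development inside a spacetime along an isometric open embedding**
(Sbierski 2016, §2, Remark (2) after Def. 2.4). Let `𝒰` be a Cauchy development of `D`,
`𝒯₁`, `𝒯₂` spacetimes of the same dimension, `J : M_𝒰 → M₁` a smooth time-orientation preserving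
isometric open embedding and `K : M_𝒰 → M₂` a smooth time-orientation preserving isometric
immersion, with `J ∘ ι_𝒰 = ι₁` and `K ∘ ι_𝒰 = ι₂`. Then for the open set `U = J(M_𝒰)`: `ι₁(X) ⊆ U`,
`U` is connected, `ι₁(X)` is a Cauchy hypersurface of `(U, g₁|_U, τ₁|_U)` (endless timelike curves
of `U` pull back along the isometry `J⁻¹` to endless timelike curves of `𝒰`, which meet `ι_𝒰(X)`
exactly once), and `ψ = K ∘ J⁻¹` is smooth, isometric and time-orientation preserving on `U` with
`ψ ∘ ι₁ = ι₂`. [cite: Sbierski2016AHP, §2, Def. 2.4 and Remark (2)] -/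
theorem exists_realised_range (𝒰 : CauchyDevelopment D) (𝒯₁ 𝒯₂ : Spacetime.{u} (n + 1))
    {J : 𝒰.carrier → 𝒯₁.carrier} {K : 𝒰.carrier → 𝒯₂.carrier}
    (hJo : IsOpenEmbedding J)
    (hJi : 𝒰.metric.IsIsometricImmersion 𝒯₁.metric.toPseudoRiemannianMetric J)
    (hJτ : 𝒰.timeOrientation.PreservesTimeOrientation J 𝒯₁.timeOrientation)
    (hKi : 𝒰.metric.IsIsometricImmersion 𝒯₂.metric.toPseudoRiemannianMetric K)
    (hKτ : 𝒰.timeOrientation.PreservesTimeOrientation K 𝒯₂.timeOrientation)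
    {ι₁ : X → 𝒯₁.carrier} {ι₂ : X → 𝒯₂.carrier} (hJc : J ∘ 𝒰.embed = ι₁) (hKc : K ∘ 𝒰.embed = ι₂) :
    ∃ (U : Opens 𝒯₁.carrier) (ψ : 𝒯₁.carrier → 𝒯₂.carrier),
      (U : Set 𝒯₁.carrier) = range J ∧
      (∀ u, ι₁ u ∈ U) ∧ IsConnected (U : Set 𝒯₁.carrier) ∧
      (𝒯₁.metric.restrict PseudoRiemannianMetric.contMDiff_restrict_holds U).IsCauchyHypersurface
        (𝒯₁.timeOrientation.restrict PseudoRiemannianMetric.contMDiff_restrict_holds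
          𝒯₁.timeOrientation.contMDiff_restrict_holds U) (Subtype.val ⁻¹' range ι₁) ∧
      ContMDiffOn (𝓡 (n + 1)) (𝓡 (n + 1)) ∞ ψ U ∧
      (∀ p ∈ U, pullbackBilin (I := 𝓡 (n + 1)) (I' := 𝓡 (n + 1)) ψ 𝒯₂.metric.val p =
        𝒯₁.metric.val p) ∧
      (∀ p ∈ U, 𝒯₂.timeOrientation.IsFutureDirected
        (mfderiv (𝓡 (n + 1)) (𝓡 (n + 1)) ψ p (𝒯₁.timeOrientation.vectorField p))) ∧
      (∀ x, ψ (J x) = K x) ∧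
      ψ ∘ ι₁ = ι₂ := by
  classical
  haveI : Nonempty 𝒰.carrier := inferInstance
  have hJs : ContMDiff (𝓡 (n + 1)) (𝓡 (n + 1)) ∞ J := hJi.1
  have hKs : ContMDiff (𝓡 (n + 1)) (𝓡 (n + 1)) ∞ K := hKi.1
  have hJd : MDifferentiable (𝓡 (n + 1)) (𝓡 (n + 1)) J := hJs.mdifferentiable (by simp)
  have hKd : MDifferentiable (𝓡 (n + 1)) (𝓡 (n + 1)) K := hKs.mdifferentiable (by simp)
  set Ji : 𝒯₁.carrier → 𝒰.carrier := invFun J with hJi_def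
  have hleft : ∀ x, Ji (J x) = x := leftInverse_invFun hJo.injective
  have hright : ∀ p ∈ range J, J (Ji p) = p := fun p hp ↦ invFun_eq hp
  have hJis : ContMDiffOn (𝓡 (n + 1)) (𝓡 (n + 1)) ∞ Ji (range J) :=
    Spacetime.contMDiffOn_invFun_range (𝒮 := 𝒰.toSpacetime) (𝒮' := 𝒯₁) hJi hJo.injective
  have hJid : ∀ p ∈ range J, MDifferentiableAt (𝓡 (n + 1)) (𝓡 (n + 1)) Ji p := fun p hp ↦
    ((hJis p hp).contMDiffAt (hJo.isOpen_range.mem_nhds hp)).mdifferentiableAt (by simp)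
  have hdd : ∀ (x : 𝒰.carrier) (w : TangentSpace (𝓡 (n + 1)) (J x)),
      mfderiv (𝓡 (n + 1)) (𝓡 (n + 1)) J (Ji (J x)) (mfderiv (𝓡 (n + 1)) (𝓡 (n + 1)) Ji (J x) w)
        = w :=
    Spacetime.mfderiv_comp_mfderiv_invFun (𝒮 := 𝒰.toSpacetime) (𝒮' := 𝒯₁) hJi hJo.injective hJo
  have hval : ∀ (x : 𝒰.carrier) (v w : TangentSpace (𝓡 (n + 1)) (J x)),
      𝒰.metric.val (Ji (J x)) (mfderiv (𝓡 (n + 1)) (𝓡 (n + 1)) Ji (J x) v)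
        (mfderiv (𝓡 (n + 1)) (𝓡 (n + 1)) Ji (J x) w) = 𝒯₁.metric.val (J x) v w := by
    intro x v w
    have h := congrArg (fun b ↦ b (mfderiv (𝓡 (n + 1)) (𝓡 (n + 1)) Ji (J x) v)
      (mfderiv (𝓡 (n + 1)) (𝓡 (n + 1)) Ji (J x) w)) (hJi.2 (Ji (J x)))
    simp only [pullbackBilin_apply] at h
    rw [hdd, hdd] at h
    rw [hleft] at h ⊢
    exact h.symm
  have hfut : ∀ (x : 𝒰.carrier) (v : TangentSpace (𝓡 (n + 1)) (J x)),
      𝒯₁.timeOrientation.IsFutureDirected v →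
        𝒰.timeOrientation.IsFutureDirected (mfderiv (𝓡 (n + 1)) (𝓡 (n + 1)) Ji (J x) v) := by
    intro x v hv
    refine hJτ.isFutureDirected_of_mfderiv hJi.2 ?_
    rw [hdd]
    rw [hleft]
    exact hv
  refine ⟨⟨range J, hJo.isOpen_range⟩, K ∘ Ji, rfl, fun u ↦ ?_, ?_, ?_, ?_, ?_, ?_, fun x ↦ ?_, ?_⟩
  · exact ⟨𝒰.embed u, congrFun hJc u⟩
  · exact isConnected_range hJs.continuous
  · -- `ι₁(X)` is a Cauchy hypersurface of the sub-spacetime `range J`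
    intro γ s hγ
    obtain ⟨hs, hγt, hγf, hγp⟩ := hγ
    have hγM : 𝒯₁.metric.IsFutureTimelikeCurveOn 𝒯₁.timeOrientation (Subtype.val ∘ γ) s :=
      (LorentzianMetric.isFutureTimelikeCurveOn_restrict_iff 𝒯₁.metric 𝒯₁.timeOrientation
        PseudoRiemannianMetric.contMDiff_restrict_holds
        𝒯₁.timeOrientation.contMDiff_restrict_holds _).1 hγt
    set δ : ℝ → 𝒰.carrier := fun t ↦ Ji (γ t : 𝒯₁.carrier) with hδ_def
    have hJδ : ∀ t, J (δ t) = (γ t : 𝒯₁.carrier) := fun t ↦ hright _ (γ t).2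
    have hδt : 𝒰.metric.IsFutureTimelikeCurveOn 𝒰.timeOrientation δ s := by
      intro t ht
      obtain ⟨hd, h1, h2⟩ := hγM t ht
      obtain ⟨x, hx⟩ := (γ t).2
      have hdδ : HasMFDerivAt 𝓘(ℝ, ℝ) (𝓡 (n + 1)) δ t
          ((mfderiv (𝓡 (n + 1)) (𝓡 (n + 1)) Ji (γ t : 𝒯₁.carrier)).comp
            (mfderiv 𝓘(ℝ, ℝ) (𝓡 (n + 1)) (Subtype.val ∘ γ) t)) :=
        (hJid _ (γ t).2).hasMFDerivAt.comp t hd.hasMFDerivAt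
      have hvel : velocity (𝓡 (n + 1)) δ t =
          mfderiv (𝓡 (n + 1)) (𝓡 (n + 1)) Ji (γ t : 𝒯₁.carrier)
            (velocity (𝓡 (n + 1)) (Subtype.val ∘ γ) t) := by
        simp only [velocity]; rw [hdδ.mfderiv]; rfl
      refine ⟨hdδ.mdifferentiableAt, ?_, ?_⟩
      · change 𝒰.metric.val (δ t) (velocity (𝓡 (n + 1)) δ t) (velocity (𝓡 (n + 1)) δ t) < 0
        rw [hvel]
        have hv := hval x
        rw [hx] at hv
        rw [show δ t = Ji (γ t : 𝒯₁.carrier) from rfl, hv]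
        exact h1
      · rw [hvel]
        have hf := hfut x
        rw [hx] at hf
        exact hf _ h2
    have hδf : IsFutureEndless δ s := by
      refine ⟨hγf.1, fun q hq ↦ hγf.2 ⟨J q, q, rfl⟩ ?_⟩
      have h1 : HasFutureEndpoint (J ∘ δ) s (J q) := (hJs.continuous.tendsto q).comp hq
      have h2 : HasFutureEndpoint (Subtype.val ∘ γ) s (J q) := h1.congr fun t ↦ hJδ t
      exact hasFutureEndpoint_subtypeVal_comp_iff.1 h2
    have hδp : IsPastEndless δ s := by
      refine ⟨hγp.1, fun q hq ↦ hγp.2 ⟨J q, q, rfl⟩ ?_⟩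
      have h1 : HasPastEndpoint (J ∘ δ) s (J q) := (hJs.continuous.tendsto q).comp hq
      have h2 : HasPastEndpoint (Subtype.val ∘ γ) s (J q) := h1.congr fun t ↦ hJδ t
      exact hasPastEndpoint_subtypeVal_comp_iff.1 h2
    obtain ⟨t₀, ⟨ht₀s, u₀, hu₀⟩, huniq⟩ := 𝒰.isCauchyHypersurface δ s ⟨hs, hδt, hδf, hδp⟩
    refine ⟨t₀, ⟨ht₀s, u₀, ?_⟩, fun t ht ↦ huniq t ⟨ht.1, ?_⟩⟩
    · show ι₁ u₀ = (γ t₀ : 𝒯₁.carrier)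
      rw [← hJδ t₀, ← hu₀]; exact (congrFun hJc u₀).symm
    · obtain ⟨u, hu⟩ := ht.2
      refine ⟨u, ?_⟩
      show 𝒰.embed u = Ji (γ t : 𝒯₁.carrier)
      rw [← hu, show ι₁ u = J (𝒰.embed u) from (congrFun hJc u).symm, hleft]
  · exact hKs.comp_contMDiffOn hJis
  · rintro _ ⟨x, rfl⟩
    ext v w
    have hc := mfderiv_comp (J x) (hKd (Ji (J x))) (hJid (J x) ⟨x, rfl⟩)
    have hk := congrArg (fun b ↦ b (mfderiv (𝓡 (n + 1)) (𝓡 (n + 1)) Ji (J x) v)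
      (mfderiv (𝓡 (n + 1)) (𝓡 (n + 1)) Ji (J x) w)) (hKi.2 (Ji (J x)))
    simp only [pullbackBilin_apply] at hk ⊢
    rw [hc]
    exact hk.trans (hval x v w)
  · rintro _ ⟨x, rfl⟩
    rw [mfderiv_comp (J x) (hKd (Ji (J x))) (hJid (J x) ⟨x, rfl⟩)]
    exact hKτ.isFutureDirected_mfderiv hKi.2
      (hfut x _ (𝒯₁.timeOrientation.isFutureDirected_vectorField (J x)))
  · show K (Ji (J x)) = K x
    rw [hleft]
  · funext u
    show K (Ji (ι₁ u)) = ι₂ u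
    rw [show ι₁ u = J (𝒰.embed u) from (congrFun hJc u).symm, hleft]
    exact congrFun hKc u

end CauchyDevelopment

end Literature.Geometry.Lorentzian

end
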